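import Literature.Analysis.FluidPDE.HolderHalfDirectionStretching
import Literature.Analysis.FluidPDE.LeraySeparationOfEnergyTools
import HarnessLib

/-!
# CriticalCoherenceDoorDepletion — door S33 «CriticalCoherenceDoor» (nsreg-p1 ROUND-31, texts
# `r31/Sketch33.lean` ae52fe0f17f630b4), plate T33 sub-bricks T33a/T33b

Tools for the two-threshold stretching estimate `TwoThresholdStretching` (plate T33):

* §1 the VALUE cut-off of a field at general radii `0 ≤ a < b`: the "x-high part"
  `Z(y) = (1 − θ_{a,b}(w y)) w(y)` (`θ_{a,b} = radialCutoff a b`, `= 1` on `|z| ≤ a`, `= 0` on `|z| ≥ b`) —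
  size, support in `{|w| > a}`, `C¹`, compact support, and the LAYER GRADIENT BOUND
  `‖∇Z‖ ≤ (1 + C b/(b − a)) ‖∇w‖` (T33b: with `a = Ωₓ`, `b = (1+η)Ωₓ` the constant is `1 + C(1+η)/η`,
  FREE OF `Ωₓ` — the audit point of ROUND-31 §1 (C));
* §2 the TWO-THRESHOLD geometric depletion (T33a): under the pair hypothesis
  `√(1 − ⟪ξ(x), ξ(y)⟫²) ≤ M |x − y|^{1/2}` for `|w(x)| > a`, `|w(y)| > Ω` (`Ω ≤ R`), at every `x`
  `|⟪Z(x), ∇(K ∗ w_hi)(x) Z(x)⟫| ≤ A M |w(x)|² ∫ |x − y|^{-5/2} |w_hi(y)| dy`, `w_hi` the tree's high part at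
  the `y`-threshold `R` — the two-field copy of `exists_abs_inner_highPart_fderiv_biotSavart_le_holder`.

HONEST FRAME: S33 is a regularity CRITERION (coherent scale-critical intense set ⇒ continuation),
Type-II-inclusive; nothing here bears on item 0056 `NoTypeII` or on NS regularity itself.
-/

noncomputable section

set_option linter.dupNamespace false

namespace Summit.NavierStokesRegularity.NavierStokesRegularity.Theorems.CriticalCoherenceDoor

open MeasureTheory Set Function Filter Metric Real InnerProductSpace
open _root_.Topology
open scoped ENNReal NNReal RealInnerProductSpace
open Literature.Analysis Literature.Analysis.FluidPDE

-- nested operator types (second derivatives)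
set_option maxSynthPendingDepth 3

/-! ### §1 The value cut-off at general radii -/

section XHighPart

variable {w : (EuclideanSpace ℝ (Fin 3)) → (EuclideanSpace ℝ (Fin 3))} {a b : ℝ}

/-- `‖Z(y)‖ ≤ ‖w(y)‖` for the x-high part `Z = (1 − θ_{a,b}(w)) w`. [folklore] -/
theorem norm_xHighPart_le_norm (w : (EuclideanSpace ℝ (Fin 3)) → (EuclideanSpace ℝ (Fin 3)))
    (a b : ℝ) (y : EuclideanSpace ℝ (Fin 3)) :
    ‖(1 - radialCutoff a b (w y)) • w y‖ ≤ ‖w y‖ := by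
  rw [norm_smul, Real.norm_eq_abs, abs_of_nonneg (sub_nonneg.2 (radialCutoff_le_one _ _ _))]
  exact mul_le_of_le_one_left (norm_nonneg _) (sub_le_self _ (radialCutoff_nonneg _ _ _))

/-- `Z(y) = 0` where `|w(y)| ≤ a` (`0 ≤ a < b`). [folklore] -/
theorem xHighPart_eq_zero_of_norm_le (ha : 0 ≤ a) (hab : a < b) {y : EuclideanSpace ℝ (Fin 3)}
    (hy : ‖w y‖ ≤ a) : (1 - radialCutoff a b (w y)) • w y = 0 := by
  rw [radialCutoff_eq_one ha hab hy, sub_self, zero_smul]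

/-- `Z(y) ≠ 0 ⇒ |w(y)| > a` (`0 ≤ a < b`): the x-high part lives where `|w| > a`. [folklore] -/
theorem lt_norm_of_xHighPart_ne_zero (ha : 0 ≤ a) (hab : a < b) {y : EuclideanSpace ℝ (Fin 3)}
    (hy : (1 - radialCutoff a b (w y)) • w y ≠ 0) : a < ‖w y‖ := by
  by_contra h
  exact hy (xHighPart_eq_zero_of_norm_le ha hab (not_lt.1 h))

/-- `θ_{a,b}(w y) ≠ 0 ⇒ |w(y)| < b` (`0 ≤ a < b`): the low weight lives where `|w| < b`. [folklore] -/
theorem norm_lt_of_radialCutoff_ne_zero (ha : 0 ≤ a) (hab : a < b) {y : EuclideanSpace ℝ (Fin 3)}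
    (hy : radialCutoff a b (w y) ≠ 0) : ‖w y‖ < b := by
  by_contra h
  exact hy (radialCutoff_eq_zero ha hab (not_lt.1 h))

/-- The x-high part is parallel to the direction field: `Z(y) = ((1 − θ(w y))‖w y‖) • ξ(y)`. [folklore] -/
theorem xHighPart_eq_smul_vorticityDirection (w : (EuclideanSpace ℝ (Fin 3)) → (EuclideanSpace ℝ (Fin 3)))
    (a b : ℝ) (y : EuclideanSpace ℝ (Fin 3)) :
    (1 - radialCutoff a b (w y)) • w y =
      ((1 - radialCutoff a b (w y)) * ‖w y‖) • vorticityDirection w y := by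
  rw [vorticityDirection_apply, smul_smul]
  by_cases h : w y = 0
  · simp [h]
  · rw [mul_assoc, mul_inv_cancel₀ (norm_ne_zero_iff.2 h), mul_one]

/-- `Z` is `C¹` for `C¹` fields. [folklore] -/
theorem contDiff_xHighPart (hw : ContDiff ℝ 1 w) (a b : ℝ) :
    ContDiff ℝ 1 fun y => (1 - radialCutoff a b (w y)) • w y :=
  (contDiff_const.sub ((radialCutoff_contDiff (E' := EuclideanSpace ℝ (Fin 3)) a b (n := 1)).comp hw)).smul hw

/-- `‖∇θ_{a,b}(z)‖ ‖z‖ ≤ C b/(b − a)` everywhere (`0 ≤ a < b`; `∇θ = 0` off `|z| ≤ b`), `C` the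
absolute constant of `exists_norm_fderiv_radialCutoff_le_div`. [folklore] -/
theorem norm_fderiv_radialCutoff_mul_norm_le_gen {C : ℝ} (hC0 : 0 ≤ C)
    (hC : ∀ ⦃r₀ r₁ : ℝ⦄, 0 ≤ r₀ → r₀ < r₁ →
      ∀ z : EuclideanSpace ℝ (Fin 3), ‖fderiv ℝ (radialCutoff r₀ r₁ : EuclideanSpace ℝ (Fin 3) → ℝ) z‖ ≤
        C / (r₁ - r₀))
    (ha : 0 ≤ a) (hab : a < b) (z : EuclideanSpace ℝ (Fin 3)) :
    ‖fderiv ℝ (radialCutoff a b : EuclideanSpace ℝ (Fin 3) → ℝ) z‖ * ‖z‖ ≤ C * b / (b - a) := by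
  have hb : 0 < b := lt_of_le_of_lt ha hab
  have hba : 0 < b - a := sub_pos.2 hab
  rcases lt_or_ge b ‖z‖ with hz | hz
  · have hev := radialCutoff_eventuallyEq_zero (E := EuclideanSpace ℝ (Fin 3)) ha hab hz
    rw [hev.fderiv_eq, fderiv_const_apply, norm_zero, zero_mul]
    positivity
  · calc ‖fderiv ℝ (radialCutoff a b : EuclideanSpace ℝ (Fin 3) → ℝ) z‖ * ‖z‖ ≤ C / (b - a) * b := by
          gcongr
          exact hC ha hab z
      _ = C * b / (b - a) := by field_simp

/-- **Layer gradient bound for the x-high part (T33b)**: `‖∇Z(y)‖ ≤ (1 + C b/(b − a)) ‖∇w(y)‖`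
(`∇Z = (1 − θ∘w)∇w − (∇θ(w y) ∘ ∇w(y)) ⊗ w(y)` and `‖∇θ(z)‖|z| ≤ C b/(b − a)`); with `a = Ωₓ`,
`b = (1+η)Ωₓ` the constant is `1 + C(1+η)/η`, independent of `Ωₓ`. [folklore] -/
theorem norm_fderiv_xHighPart_le (hw : ContDiff ℝ 1 w) {C : ℝ} (hC0 : 0 ≤ C)
    (hC : ∀ ⦃r₀ r₁ : ℝ⦄, 0 ≤ r₀ → r₀ < r₁ →
      ∀ z : EuclideanSpace ℝ (Fin 3), ‖fderiv ℝ (radialCutoff r₀ r₁ : EuclideanSpace ℝ (Fin 3) → ℝ) z‖ ≤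
        C / (r₁ - r₀))
    (ha : 0 ≤ a) (hab : a < b) (y : EuclideanSpace ℝ (Fin 3)) :
    ‖fderiv ℝ (fun y => (1 - radialCutoff a b (w y)) • w y) y‖ ≤
      (1 + C * b / (b - a)) * ‖fderiv ℝ w y‖ := by
  have hθ : ContDiff ℝ 1 (radialCutoff a b : (EuclideanSpace ℝ (Fin 3)) → ℝ) := radialCutoff_contDiff a b
  have hwd : DifferentiableAt ℝ w y := (hw.differentiable one_ne_zero) y
  have hθd : DifferentiableAt ℝ (radialCutoff a b : (EuclideanSpace ℝ (Fin 3)) → ℝ) (w y) :=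
    (hθ.differentiable one_ne_zero) _
  have hcomp : HasFDerivAt (fun y => radialCutoff a b (w y))
      ((fderiv ℝ (radialCutoff a b : (EuclideanSpace ℝ (Fin 3)) → ℝ) (w y)).comp (fderiv ℝ w y)) y :=
    hθd.hasFDerivAt.comp y hwd.hasFDerivAt
  have hfac : HasFDerivAt (fun y => 1 - radialCutoff a b (w y))
      (-((fderiv ℝ (radialCutoff a b : (EuclideanSpace ℝ (Fin 3)) → ℝ) (w y)).comp (fderiv ℝ w y))) y := by
    have h2 := (hasFDerivAt_const (1 : ℝ) y).fun_sub hcomp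
    rwa [zero_sub] at h2
  have hprod := hfac.fun_smul hwd.hasFDerivAt
  rw [hprod.fderiv]
  have h0 : 0 ≤ 1 - radialCutoff a b (w y) := sub_nonneg.2 (radialCutoff_le_one _ _ _)
  have h1 : 1 - radialCutoff a b (w y) ≤ 1 := sub_le_self _ (radialCutoff_nonneg _ _ _)
  calc ‖(1 - radialCutoff a b (w y)) • fderiv ℝ w y +
          (-((fderiv ℝ (radialCutoff a b : (EuclideanSpace ℝ (Fin 3)) → ℝ) (w y)).comp
            (fderiv ℝ w y))).smulRight (w y)‖
      ≤ ‖(1 - radialCutoff a b (w y)) • fderiv ℝ w y‖ +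
          ‖(-((fderiv ℝ (radialCutoff a b : (EuclideanSpace ℝ (Fin 3)) → ℝ) (w y)).comp
            (fderiv ℝ w y))).smulRight (w y)‖ := norm_add_le _ _
    _ ≤ 1 * ‖fderiv ℝ w y‖ +
          ‖fderiv ℝ (radialCutoff a b : (EuclideanSpace ℝ (Fin 3)) → ℝ) (w y)‖ * ‖fderiv ℝ w y‖ *
            ‖w y‖ := by
        gcongr
        · rw [norm_smul, Real.norm_eq_abs, abs_of_nonneg h0]
          exact mul_le_mul_of_nonneg_right h1 (norm_nonneg _)
        · rw [ContinuousLinearMap.norm_smulRight_apply, norm_neg]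
          gcongr
          exact ContinuousLinearMap.opNorm_comp_le _ _
    _ = ‖fderiv ℝ w y‖ +
          (‖fderiv ℝ (radialCutoff a b : (EuclideanSpace ℝ (Fin 3)) → ℝ) (w y)‖ * ‖w y‖) *
            ‖fderiv ℝ w y‖ := by ring
    _ ≤ ‖fderiv ℝ w y‖ + C * b / (b - a) * ‖fderiv ℝ w y‖ := by
        gcongr
        exact norm_fderiv_radialCutoff_mul_norm_le_gen hC0 hC ha hab (w y)
    _ = (1 + C * b / (b - a)) * ‖fderiv ℝ w y‖ := by ring

/-- The x-high part has compact support when `w → 0` at infinity (`0 < a < b`). [folklore] -/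
theorem hasCompactSupport_xHighPart (ha : 0 < a) (hab : a < b)
    (hw0 : Tendsto w (cocompact (EuclideanSpace ℝ (Fin 3))) (𝓝 0)) :
    HasCompactSupport fun y => (1 - radialCutoff a b (w y)) • w y := by
  have hev : ∀ᶠ y in cocompact (EuclideanSpace ℝ (Fin 3)), ‖w y‖ < a := by
    have h := Metric.tendsto_nhds.1 hw0 a ha
    filter_upwards [h] with y hy
    simpa [dist_zero_right] using hy
  obtain ⟨t, ht, hts⟩ := mem_cocompact.1 hev
  obtain ⟨r, hr⟩ := ht.isBounded.subset_closedBall (0 : (EuclideanSpace ℝ (Fin 3)))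
  refine HasCompactSupport.of_support_subset_isCompact
    (isCompact_closedBall (0 : (EuclideanSpace ℝ (Fin 3))) r) ?_
  intro y hy
  by_contra hyr
  have hyt : y ∈ tᶜ := fun h => hyr (hr h)
  exact hy (xHighPart_eq_zero_of_norm_le ha.le hab (le_of_lt (hts hyt)))

/-- The low weight `1 − (1 − θ)²` lies in `[0, 1]`. [folklore] -/
theorem lowWeight_mem_Icc (a b : ℝ) (z : EuclideanSpace ℝ (Fin 3)) :
    0 ≤ 1 - (1 - radialCutoff a b z) ^ 2 ∧ 1 - (1 - radialCutoff a b z) ^ 2 ≤ 1 := by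
  have h0 := radialCutoff_nonneg a b z
  have h1 := radialCutoff_le_one a b z
  constructor <;> nlinarith

/-- The low weight vanishes where `|w| ≥ b` (`0 ≤ a < b`). [folklore] -/
theorem lowWeight_eq_zero_of_le_norm (ha : 0 ≤ a) (hab : a < b) {y : EuclideanSpace ℝ (Fin 3)}
    (hy : b ≤ ‖w y‖) : 1 - (1 - radialCutoff a b (w y)) ^ 2 = 0 := by
  rw [radialCutoff_eq_zero ha hab hy]; ring

end XHighPart

/-! ### §2 The two-threshold geometric depletion (T33a) -/

/-- `√r · (r³)⁻¹ = r^{-5/2}` for `r > 0`. [folklore] -/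
theorem sqrt_mul_inv_cube' {r : ℝ} (hr : 0 < r) :
    Real.sqrt r * (r ^ 3)⁻¹ = r ^ (-(5 / 2 : ℝ)) := by
  rw [Real.sqrt_eq_rpow, ← Real.rpow_natCast, ← Real.rpow_neg hr.le, ← Real.rpow_add hr]
  norm_num

/-- The potential `∫ |x−y|^{-5/2} |h(y)| dy` of a continuous compactly supported `h` converges
absolutely (domination by `sup|h| · 1_{ball}(x−y)|x−y|^{-5/2}`, `5/2 < 3`). [folklore] -/
theorem integrable_rieszHalfKernel_mul_norm'
    {h : (EuclideanSpace ℝ (Fin 3)) → (EuclideanSpace ℝ (Fin 3))} (hh : Continuous h)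
    (hhc : HasCompactSupport h) (x : (EuclideanSpace ℝ (Fin 3))) :
    Integrable fun y => ‖x - y‖ ^ (-(5 / 2 : ℝ)) * ‖h y‖ := by
  obtain ⟨M₀, hM₀⟩ := hh.bounded_above_of_compact_support hhc
  have hM₀0 : 0 ≤ M₀ := (norm_nonneg _).trans (hM₀ x)
  obtain ⟨R₀, hR₀⟩ := hhc.isCompact.isBounded.subset_closedBall (0 : (EuclideanSpace ℝ (Fin 3)))
  set ρ' : ℝ := |R₀| + ‖x‖ + 1 with hρ'
  have hball : Integrable fun z : (EuclideanSpace ℝ (Fin 3)) =>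
      (ball (0 : (EuclideanSpace ℝ (Fin 3))) ρ').indicator (fun z => ‖z‖ ^ (-(5 / 2 : ℝ))) z := by
    rw [integrable_indicator_iff measurableSet_ball]
    exact NewtonPotentialHolder.integrableOn_ball_norm_rpow_neg (by norm_num) ρ'
  have hmaj : Integrable fun y => M₀ *
      (ball (0 : (EuclideanSpace ℝ (Fin 3))) ρ').indicator (fun z => ‖z‖ ^ (-(5 / 2 : ℝ))) (x - y) :=
    (hball.comp_sub_left x).const_mul _
  have hmeas : AEStronglyMeasurable (fun y => ‖x - y‖ ^ (-(5 / 2 : ℝ)) * ‖h y‖) volume :=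
    (((measurable_const.sub measurable_id).norm.pow_const _).mul
      hh.measurable.norm).aestronglyMeasurable
  refine hmaj.mono' hmeas (Eventually.of_forall fun y => ?_)
  have hk0 : 0 ≤ ‖x - y‖ ^ (-(5 / 2 : ℝ)) := Real.rpow_nonneg (norm_nonneg _) _
  rw [Real.norm_of_nonneg (mul_nonneg hk0 (norm_nonneg _))]
  by_cases hy : h y = 0
  · rw [hy, norm_zero, mul_zero]
    exact mul_nonneg hM₀0 (indicator_nonneg (fun z _ => Real.rpow_nonneg (norm_nonneg _) _) _)
  · have hyR : ‖y‖ ≤ R₀ := mem_closedBall_zero_iff.1 (hR₀ (subset_tsupport _ (mem_support.2 hy)))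
    have hxy : ‖x - y‖ < ρ' := by
      calc ‖x - y‖ ≤ ‖x‖ + ‖y‖ := norm_sub_le _ _
        _ < |R₀| + ‖x‖ + 1 := by linarith [le_abs_self R₀]
    have hmem : x - y ∈ ball (0 : (EuclideanSpace ℝ (Fin 3))) ρ' := mem_ball_zero_iff.2 hxy
    rw [indicator_of_mem hmem]
    calc ‖x - y‖ ^ (-(5 / 2 : ℝ)) * ‖h y‖ ≤ ‖x - y‖ ^ (-(5 / 2 : ℝ)) * M₀ :=
          mul_le_mul_of_nonneg_left (hM₀ y) hk0
      _ = M₀ * ‖x - y‖ ^ (-(5 / 2 : ℝ)) := mul_comm _ _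

/-- **Two-threshold geometric depletion (T33a)** (two-field copy of
`exists_abs_inner_highPart_fderiv_biotSavart_le_holder`; Beirão da Veiga–Berselli 2002 (4.6),
Lemarié-Rieusset 2016 Thm. 11.7 proof). There is an absolute `A ≥ 0` such that: for a `C¹` field `w`,
a `y`-threshold `R > 0` whose high part `w_hi = (1 − θ_R(w)) w` has compact support, `Ω ≤ R`, general
`x`-radii `0 ≤ a < b`, `M ≥ 0`, and the PAIR hypothesis `√(1 − ⟪ξ(x), ξ(y)⟫²) ≤ M |x−y|^{1/2}` whenever
`|w(x)| > a` and `|w(y)| > Ω`, one has at every `x`, with `Z = (1 − θ_{a,b}(w)) w`,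
`|⟪Z(x), ∇(K ∗ w_hi)(x) Z(x)⟫| ≤ A M |w(x)|² ∫ |x−y|^{-5/2} |w_hi(y)| dy`. [folklore] -/
theorem exists_abs_inner_xHighPart_fderiv_biotSavart_highPart_le :
    ∃ A : ℝ, 0 ≤ A ∧ ∀ ⦃w : (EuclideanSpace ℝ (Fin 3)) → (EuclideanSpace ℝ (Fin 3))⦄
      (_ : ContDiff ℝ 1 w) ⦃R Ω a b M : ℝ⦄ (_ : 0 < R) (_ : Ω ≤ R) (_ : 0 ≤ a) (_ : a < b) (_ : 0 ≤ M)
      (_ : HasCompactSupport fun y => (1 - radialCutoff R (2 * R) (w y)) • w y)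
      (_ : ∀ x y, a < ‖w x‖ → Ω < ‖w y‖ →
        Real.sqrt (1 - ⟪vorticityDirection w x, vorticityDirection w y⟫ ^ 2) ≤
          M * Real.sqrt ‖x - y‖) (x : (EuclideanSpace ℝ (Fin 3))),
      |⟪(1 - radialCutoff a b (w x)) • w x,
        fderiv ℝ (biotSavart fun y => (1 - radialCutoff R (2 * R) (w y)) • w y) x
          ((1 - radialCutoff a b (w x)) • w x)⟫| ≤
        A * M * ‖w x‖ ^ 2 *
          ∫ y, ‖x - y‖ ^ (-(5 / 2 : ℝ)) * ‖(1 - radialCutoff R (2 * R) (w y)) • w y‖ := by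
  obtain ⟨A, hA0, hdep⟩ := exists_abs_inner_fderiv_biotSavart_le
  refine ⟨A, hA0, ?_⟩
  intro w hw R Ω a b M hR hΩR ha hab hM hhic hdir x
  set hi : (EuclideanSpace ℝ (Fin 3)) → (EuclideanSpace ℝ (Fin 3)) :=
    fun y => (1 - radialCutoff R (2 * R) (w y)) • w y with hhi
  have hhi1 : ContDiff ℝ 1 hi := contDiff_highPart hw R
  have hhicont : Continuous hi := hhi1.continuous
  set P : ℝ := ∫ y, ‖x - y‖ ^ (-(5 / 2 : ℝ)) * ‖hi y‖ with hP
  have hP0 : 0 ≤ P := integral_nonneg fun y =>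
    mul_nonneg (Real.rpow_nonneg (norm_nonneg _) _) (norm_nonneg _)
  by_cases hx : (1 - radialCutoff a b (w x)) • w x = 0
  · rw [hx, inner_zero_left, abs_zero]
    positivity
  -- the direction at `x`
  have hwa : a < ‖w x‖ := lt_norm_of_xHighPart_ne_zero ha hab hx
  have hw0 : w x ≠ 0 := by
    intro h; rw [h, norm_zero] at hwa; exact lt_irrefl _ (ha.trans_lt hwa)
  set e : (EuclideanSpace ℝ (Fin 3)) := vorticityDirection w x with he
  have he1 : ‖e‖ = 1 := norm_vorticityDirection w hw0
  set c : ℝ := (1 - radialCutoff a b (w x)) * ‖w x‖ with hc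
  have hZx : (1 - radialCutoff a b (w x)) • w x = c • e := xHighPart_eq_smul_vorticityDirection w a b x
  have hc0 : 0 ≤ c := mul_nonneg (sub_nonneg.2 (radialCutoff_le_one _ _ _)) (norm_nonneg _)
  have hcle : c ≤ ‖w x‖ :=
    mul_le_of_le_one_left (norm_nonneg _) (sub_le_self _ (radialCutoff_nonneg _ _ _))
  -- `hi x` is parallel to `e` as well
  have hhix : ∃ c' : ℝ, hi x = c' • e := ⟨(1 - radialCutoff R (2 * R) (w x)) * ‖w x‖,
    highPart_eq_smul_vorticityDirection w R x⟩
  -- Hölder continuity of the high part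
  obtain ⟨Cl, hCl⟩ := hhi1.lipschitzWith_of_hasCompactSupport hhic one_ne_zero
  have hhol : HolderWith Cl 1 hi := hCl.holderWith
  -- the depleted majorant
  set g : (EuclideanSpace ℝ (Fin 3)) → ℝ := fun y => A * M * (‖x - y‖ ^ (-(5 / 2 : ℝ)) * ‖hi y‖)
    with hg
  have hgi : Integrable g := (integrable_rieszHalfKernel_mul_norm' hhicont hhic x).const_mul (A * M)
  have hdom : ∀ y, y ≠ x → A * ‖hi y - ⟪hi y, e⟫ • e‖ * (‖x - y‖ ^ 3)⁻¹ ≤ g y := by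
    intro y hyx
    have hr : 0 < ‖x - y‖ := norm_pos_iff.2 (sub_ne_zero.2 (Ne.symm hyx))
    have hle : ‖hi y - ⟪hi y, e⟫ • e‖ ≤ ‖hi y‖ * min 1 (M * Real.sqrt ‖x - y‖) := by
      refine norm_highPart_sub_inner_smul_le hR he1 fun hyR => ?_
      exact hdir x y hwa (hΩR.trans_lt hyR)
    have hle' : ‖hi y - ⟪hi y, e⟫ • e‖ ≤ ‖hi y‖ * (M * Real.sqrt ‖x - y‖) :=
      hle.trans (mul_le_mul_of_nonneg_left (min_le_right _ _) (norm_nonneg _))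
    rw [hg]
    calc A * ‖hi y - ⟪hi y, e⟫ • e‖ * (‖x - y‖ ^ 3)⁻¹
        ≤ A * (‖hi y‖ * (M * Real.sqrt ‖x - y‖)) * (‖x - y‖ ^ 3)⁻¹ := by gcongr
      _ = A * M * ((Real.sqrt ‖x - y‖ * (‖x - y‖ ^ 3)⁻¹) * ‖hi y‖) := by ring
      _ = A * M * (‖x - y‖ ^ (-(5 / 2 : ℝ)) * ‖hi y‖) := by rw [sqrt_mul_inv_cube' hr]
  have hkey := hdep one_pos hhol hhic he1 hhix hgi hdom
  -- assemble
  have hinner : ⟪(1 - radialCutoff a b (w x)) • w x,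
      fderiv ℝ (biotSavart hi) x ((1 - radialCutoff a b (w x)) • w x)⟫ =
      c ^ 2 * ⟪e, fderiv ℝ (biotSavart hi) x e⟫ := by
    rw [hZx, map_smul, real_inner_smul_left, real_inner_smul_right]
    ring
  show |⟪(1 - radialCutoff a b (w x)) • w x,
      fderiv ℝ (biotSavart hi) x ((1 - radialCutoff a b (w x)) • w x)⟫| ≤ A * M * ‖w x‖ ^ 2 * P
  rw [hinner, abs_mul, abs_of_nonneg (sq_nonneg c)]
  have hint_le : ∫ y, g y = A * M * P := by
    rw [hg, integral_const_mul]
  calc c ^ 2 * |⟪e, fderiv ℝ (biotSavart hi) x e⟫| ≤ ‖w x‖ ^ 2 * (A * M * P) :=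
        mul_le_mul (pow_le_pow_left₀ hc0 hcle 2) (hkey.trans hint_le.le) (abs_nonneg _)
          (sq_nonneg _)
    _ = A * M * ‖w x‖ ^ 2 * P := by ring

end Summit.NavierStokesRegularity.NavierStokesRegularity.Theorems.CriticalCoherenceDoor

end
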